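import Literature.NumberTheory.Automorphic.SL2Differential
import Literature.NumberTheory.Automorphic.TorusCharacters
import Literature.NumberTheory.Automorphic.LinearAlgebraicGroupsProofs
import HarnessLib

/-!
# Velocities of Laurent curves: cocharacters and the diagonal of an `SL₂` in `Lie(G)`
(trunk T-AUTOMORPHIC, G25 AutomorphicL; Springer, *Linear Algebraic Groups*, 3.2.11, 4.4.9, 7.3.5)

Companion to `LieAlgebraGL.lean` (`lieAlgebraGL`, `tangentDeriv`, dual numbers `dualPoint`;
`coeffOneMatrix_mem_lieAlgebraGL`: velocities of *polynomial* curves through `1` lie in `Lie(G)`)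
and `SL2Differential.lean` (the differential `sl2Diff hφ` of an algebraic `φ : SL₂ → G`, which
handles the unipotent curves of `SL₂` but, as recorded there, not the diagonal one-parameter
subgroup `t ↦ diag(t, t⁻¹)`, which is a *Laurent* curve), namespace
`Literature.NumberTheory.Automorphic`. Here we treat curves `γ : 𝔾ₘ → GL_n` with Laurent-polynomial
coordinates (`Q c ∈ k[x₀, x₁]` evaluated at `(t, t⁻¹)`; the format of `IsAlgebraicCochar` and of
`HasLaurentCoords`), over an infinite field:

* **`aeval_laurentDualPoint_eq_zero`** — if `R(t, t⁻¹) = 0` for all `t ∈ kˣ` then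
  `R(1 + ε, 1 - ε) = 0` in `k[ε]` (write `R = ∑ R_s x₀^{s₀} x₁^{s₁}`; the polynomial
  `∑ R_s X^{s₀ + N - s₁}` vanishes on `kˣ`, hence is `0`, and evaluating at `1 + ε` and dividing by
  `(1 + ε)^N` — note `(1 + ε)(1 - ε) = 1` — gives the claim);
* `laurentVelocity Q` — the matrix `(∂₀ - ∂₁) Q_{ij} (1, 1)`, i.e. `(d/dt) γ(t) |_{t = 1}`;
  `aeval_laurentDualPoint_coords` — `Q (1 + ε, 1 - ε) = 1 + ε · laurentVelocity Q` *including the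
  `det⁻¹` coordinate* (through the relation `det⁻¹ · det = 1` along the curve);
  **`laurentVelocity_mem_lieAlgebraGL`** (`γ(𝔾ₘ) ⊆ H ⇒ γ'(1) ∈ Lie(H)`, Springer 4.4.9 for
  `𝔾ₘ → H`) and **`tangentDeriv_laurentVelocity`** (`p (γ(t)) = t^m` for all `t` forces
  `dp_1 (γ'(1)) = m`);
* cocharacters: `IsAlgebraicCochar.velocity`, `velocity_mem_lieAlgebraGL`,
  **`IsAlgebraicCochar.tangentDeriv_velocity`** — `dχ (dλ) = ⟨χ, λ⟩` for an algebraic character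
  `χ` and cocharacter `λ` of `T` (Springer 3.2.11: the differential of `χ ∘ λ = (t ↦ t^{⟨χ,λ⟩})`);
* the diagonal of an `SL₂`: **`sl2Diff_slH_eq_laurentVelocity`** (the value of `sl2Diff hφ` on
  `H = diag(1, -1)` is the velocity of `t ↦ φ (diag(t, t⁻¹))`), `sl2Diff_slH_mem_lieAlgebraGL`
  and **`tangentDeriv_sl2Diff_slH`**: if `p (φ (diag(t, t⁻¹))) = t^m` for all `t` then
  `dp_1 (dφ H) = m` — with `φ` the `SL₂` of a root `α` (Springer 7.3.5, 8.1.8), `p` a character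
  `χ` of the maximal torus and `φ ∘ diag = α^∨`, this is **`dχ (h_α) = ⟨χ, α^∨⟩`**, the
  infinitesimal form of the definition of the coroot, used by the Lie-algebra isomorphism theorem
  on the DAG of `chevalley_isomorphism`.

## Mathlib

`MvPolynomial.eval_eq`, `MvPolynomial.aeval`, `MvPolynomial.degreeOf`,
`MvPolynomial.monomial_le_degreeOf`, `Polynomial.eq_zero_of_infinite_isRoot`, `TrivSqZeroExt` /
`DualNumber`, `Matrix.det_fin_two`. Mathlib has no algebraic groups; nothing here duplicates a
Mathlib or Literature declaration (searched `laurentVelocity`, `laurentDualPoint`,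
`IsAlgebraicCochar.velocity`).

## References

* T. A. Springer, *Linear Algebraic Groups*, 2nd ed., Progress in Mathematics 9, Birkhäuser
  (1998), 3.2.11, 4.1.9 (3), 4.4.9, 7.3.5, 8.1.8 [SpringerLAG1998].
-/

noncomputable section

open scoped MatrixGroups
open TrivSqZeroExt DualNumber MvPolynomial

namespace Literature.NumberTheory.Automorphic

variable {k : Type*} [Field k]

/-! ### Laurent polynomials vanishing on `kˣ` vanish at the dual point `(1 + ε, 1 - ε)` -/

section Laurent

/-- The dual-number point `(1 + ε, 1 - ε)` of the torus `x₀ x₁ = 1`: the image of `1 + ε` under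
`t ↦ (t, t⁻¹)`. [folklore] -/
def laurentDualPoint : Fin 2 → k[ε] :=
  Literature.RingTheory.KrullDimension.dualNumberPoint ![1, 1] ![1, -1]

/-- The first coordinate of `laurentDualPoint` is `1 + ε`. [folklore] -/
@[simp] lemma laurentDualPoint_zero : (laurentDualPoint : Fin 2 → k[ε]) 0 = inl 1 + inr 1 := rfl

/-- The second coordinate of `laurentDualPoint` is `1 - ε`. [folklore] -/
@[simp] lemma laurentDualPoint_one : (laurentDualPoint : Fin 2 → k[ε]) 1 = inl 1 + inr (-1) := rfl

/-- `(1 + ε)(1 - ε) = 1` in `k[ε]`. [folklore] -/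
lemma laurentDualPoint_zero_mul_one :
    (laurentDualPoint : Fin 2 → k[ε]) 0 * laurentDualPoint 1 = 1 := by
  rw [laurentDualPoint_zero, laurentDualPoint_one]
  exact TrivSqZeroExt.ext (by simp) (by simp)

/-- `(1 + a ε)^j = 1 + j a ε` in `k[ε]`. [folklore] -/
lemma inl_one_add_inr_pow (a : k) (j : ℕ) :
    ((inl 1 + inr a : k[ε])) ^ j = inl 1 + inr ((j : k) * a) := by
  induction j with
  | zero => exact TrivSqZeroExt.ext (by simp) (by simp)
  | succ j ih =>
    rw [pow_succ, ih]
    exact TrivSqZeroExt.ext (by simp) (by simp; ring)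

/-- **A Laurent polynomial vanishing on `kˣ` vanishes at `(1 + ε, 1 - ε)`.** If
`R ∈ k[x₀, x₁]` satisfies `R(t, t⁻¹) = 0` for all `t ∈ kˣ` (`k` infinite), then
`R(1 + ε, 1 - ε) = 0` in the dual numbers. [folklore] -/
theorem aeval_laurentDualPoint_eq_zero [Infinite k] (R : MvPolynomial (Fin 2) k)
    (hR : ∀ t : kˣ, MvPolynomial.eval ![(t : k), ((t⁻¹ : kˣ) : k)] R = 0) :
    MvPolynomial.aeval (laurentDualPoint (k := k)) R = 0 := by
  classical
  set N : ℕ := R.degreeOf 1 with hN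
  -- the polynomial `S(X) = ∑_s R_s X^{s₀ + N - s₁}`
  set S : Polynomial k :=
    ∑ s ∈ R.support, Polynomial.C (R.coeff s) * Polynomial.X ^ (s 0 + N - s 1) with hS
  have hs1 : ∀ s ∈ R.support, s 1 ≤ N := fun s hs =>
    hN ▸ MvPolynomial.monomial_le_degreeOf 1 hs
  -- `S(t) = t^N R(t, t⁻¹) = 0` for `t ≠ 0`
  have hSeval : ∀ t : kˣ, S.eval (t : k) = 0 := by
    intro t
    have hRt := hR t
    rw [MvPolynomial.eval_eq'] at hRt
    have key : S.eval (t : k) =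
        (t : k) ^ N * ∑ s ∈ R.support, R.coeff s * ∏ i, (![(t : k), ((t⁻¹ : kˣ) : k)] i) ^ s i := by
      rw [hS, Polynomial.eval_finsetSum, Finset.mul_sum]
      refine Finset.sum_congr rfl fun s hs => ?_
      rw [Polynomial.eval_mul, Polynomial.eval_C, Polynomial.eval_pow, Polynomial.eval_X,
        Fin.prod_univ_two, Matrix.cons_val_zero, Matrix.cons_val_one, Matrix.cons_val_fin_one]
      have h1 : (t : k) ^ (s 0 + N - s 1) * (t : k) ^ s 1 = (t : k) ^ (s 0 + N) := by
        rw [← pow_add, Nat.sub_add_cancel (by have := hs1 s hs; omega)]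
      have h2 : ((t⁻¹ : kˣ) : k) ^ s 1 * (t : k) ^ s 1 = 1 := by
        rw [← mul_pow, Units.inv_mul, one_pow]
      calc R.coeff s * (t : k) ^ (s 0 + N - s 1)
          = R.coeff s * (t : k) ^ (s 0 + N - s 1) * (((t⁻¹ : kˣ) : k) ^ s 1 * (t : k) ^ s 1) := by
            rw [h2, mul_one]
        _ = R.coeff s * ((t : k) ^ (s 0 + N - s 1) * (t : k) ^ s 1) * ((t⁻¹ : kˣ) : k) ^ s 1 := by
            ring
        _ = (t : k) ^ N * (R.coeff s * ((t : k) ^ s 0 * ((t⁻¹ : kˣ) : k) ^ s 1)) := by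
            rw [h1, pow_add]; ring
    rw [key, hRt, mul_zero]
  have hS0 : S = 0 := by
    apply Polynomial.eq_zero_of_infinite_isRoot
    refine Set.Infinite.mono (s := ({0}ᶜ : Set k)) (fun x hx => ?_) (Set.finite_singleton (0 : k)).infinite_compl
    have hx0 : x ≠ 0 := hx
    exact hSeval (Units.mk0 x hx0)
  -- evaluate `S` at `1 + ε`
  set u : k[ε] := laurentDualPoint 0 with hu
  set v : k[ε] := laurentDualPoint 1 with hv
  have huv : u * v = 1 := laurentDualPoint_zero_mul_one
  have hSu : Polynomial.aeval u S = 0 := by rw [hS0, map_zero]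
  have hpow : ∀ s ∈ R.support, u ^ (s 0 + N - s 1) = u ^ N * (u ^ s 0 * v ^ s 1) := by
    intro s hs
    have hle := hs1 s hs
    have e1 : u ^ (s 0 + N - s 1) * u ^ s 1 = u ^ N * u ^ s 0 := by
      rw [← pow_add, Nat.sub_add_cancel (by omega), pow_add, mul_comm]
    have e2 : u ^ s 1 * v ^ s 1 = 1 := by rw [← mul_pow, huv, one_pow]
    calc u ^ (s 0 + N - s 1) = u ^ (s 0 + N - s 1) * (u ^ s 1 * v ^ s 1) := by rw [e2, mul_one]
      _ = u ^ (s 0 + N - s 1) * u ^ s 1 * v ^ s 1 := by ring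
      _ = u ^ N * (u ^ s 0 * v ^ s 1) := by rw [e1]; ring
  have hexp : Polynomial.aeval u S =
      u ^ N * ∑ s ∈ R.support, algebraMap k k[ε] (R.coeff s) * (u ^ s 0 * v ^ s 1) := by
    rw [hS, map_sum, Finset.mul_sum]
    refine Finset.sum_congr rfl fun s hs => ?_
    rw [map_mul, Polynomial.aeval_C, map_pow, Polynomial.aeval_X, hpow s hs]
    ring
  have hunit : IsUnit (u ^ N) := (IsUnit.of_mul_eq_one v huv).pow N
  have hsum : ∑ s ∈ R.support, algebraMap k k[ε] (R.coeff s) * (u ^ s 0 * v ^ s 1) = 0 := by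
    have h := hSu
    rw [hexp] at h
    exact (hunit.mul_right_eq_zero).mp h
  -- and this sum is `R(1 + ε, 1 - ε)`
  have hR' : MvPolynomial.aeval (laurentDualPoint (k := k)) R =
      ∑ s ∈ R.support, algebraMap k k[ε] (R.coeff s) * (u ^ s 0 * v ^ s 1) := by
    rw [MvPolynomial.aeval_def, MvPolynomial.eval₂_eq']
    refine Finset.sum_congr rfl fun s _ => ?_
    rw [Fin.prod_univ_two]
  rw [hR', hsum]

end Laurent

/-! ### Velocities of Laurent curves in `GL_n` -/

section Curve

variable {n : Type*} [Fintype n] [DecidableEq n]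

/-- The velocity at `t = 1` of a Laurent curve `γ` in `GL_n` with Laurent coordinates `Q`
(`γ(t)_c = Q_c (t, t⁻¹)`): the matrix of `ε`-parts of `Q_{ij} (1 + ε, 1 - ε)`, i.e.
`((∂₀ - ∂₁) Q_{ij}) (1, 1) = (d/dt) γ(t)_{ij} |_{t=1}`. [folklore] -/
def laurentVelocity (Q : GLCoord n → MvPolynomial (Fin 2) k) : Matrix n n k :=
  Matrix.of fun i j => snd (MvPolynomial.aeval laurentDualPoint (Q (Sum.inl (i, j))))

/-- The `k`-part of `Q (1 + ε, 1 - ε)` is `Q (1, 1)`. [folklore] -/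
lemma fst_aeval_laurentDualPoint (R : MvPolynomial (Fin 2) k) :
    fst (MvPolynomial.aeval laurentDualPoint R) = MvPolynomial.eval ![(1 : k), 1] R :=
  Literature.RingTheory.KrullDimension.fst_aeval_dualNumberPoint _ _ R

/-- The predicate "`Q` are Laurent coordinates of the curve `γ : 𝔾ₘ → GL_n`":
`(γ t)_c = Q_c (t, t⁻¹)` for all `t ∈ kˣ` and all coordinates `c` (entries and `det⁻¹`); the
format of `IsAlgebraicCochar` and of `HasLaurentCoords`. [folklore] -/
def IsLaurentCoordsOf (γ : kˣ → GL n k) (Q : GLCoord n → MvPolynomial (Fin 2) k) : Prop :=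
  ∀ (t : kˣ) (c : GLCoord n), glCoordFun (γ t) c = MvPolynomial.eval ![(t : k), ((t⁻¹ : kˣ) : k)] (Q c)

variable {γ : kˣ → GL n k} {Q : GLCoord n → MvPolynomial (Fin 2) k}

/-- `Q_c (1, 1) = (γ 1)_c`. [folklore] -/
lemma IsLaurentCoordsOf.eval_one (hQ : IsLaurentCoordsOf γ Q) (c : GLCoord n) :
    MvPolynomial.eval ![(1 : k), 1] (Q c) = glCoordFun (γ 1) c := by
  rw [hQ 1 c]; simp

/-- **`Q (1 + ε, 1 - ε) = 1 + ε γ'(1)` in all coordinates of `GL_n`, including `det⁻¹`**, for a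
Laurent curve with `γ 1 = 1` (the `det⁻¹`-coordinate has `ε`-part `- tr γ'(1)`, from
`det⁻¹ · det = 1` along the curve and `aeval_laurentDualPoint_eq_zero`). [folklore] -/
theorem IsLaurentCoordsOf.aeval_laurentDualPoint_eq_dualPoint [Infinite k]
    (hQ : IsLaurentCoordsOf γ Q) (h1 : γ 1 = 1) :
    (fun c => MvPolynomial.aeval laurentDualPoint (Q c)) = dualPoint (laurentVelocity Q) := by
  set A := laurentVelocity Q with hA
  -- the matrix coordinates
  have hinl : ∀ i j, MvPolynomial.aeval laurentDualPoint (Q (Sum.inl (i, j))) =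
      dualPoint A (Sum.inl (i, j)) := by
    intro i j
    refine TrivSqZeroExt.ext ?_ ?_
    · rw [fst_aeval_laurentDualPoint, hQ.eval_one, h1, fst_dualPoint]
    · rw [snd_dualPoint]
      simp [tangentCoord, hA, laurentVelocity]
  funext c
  rcases c with ⟨i, j⟩ | ⟨⟩
  · exact hinl i j
  · -- the `det⁻¹` coordinate: `Q_det · det (Q_ij) - 1` vanishes along the curve
    set M : Matrix n n (MvPolynomial (Fin 2) k) := Matrix.of fun a b => Q (Sum.inl (a, b)) with hM
    set D : MvPolynomial (Fin 2) k := Q (Sum.inr ()) * M.det - 1 with hD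
    have hDt : ∀ t : kˣ, MvPolynomial.eval ![(t : k), ((t⁻¹ : kˣ) : k)] D = 0 := by
      intro t
      have hdet : MvPolynomial.eval ![(t : k), ((t⁻¹ : kˣ) : k)] M.det =
          ((γ t : GL n k) : Matrix n n k).det := by
        rw [RingHom.map_det]
        congr 1
        ext a b
        simp only [RingHom.mapMatrix_apply, Matrix.map_apply, hM, Matrix.of_apply, ← hQ t,
          glCoordFun_inl]
      have hinv : MvPolynomial.eval ![(t : k), ((t⁻¹ : kˣ) : k)] (Q (Sum.inr ())) =
          (((γ t : GL n k) : Matrix n n k).det)⁻¹ := by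
        simpa using (hQ t (Sum.inr ())).symm
      rw [hD, map_sub, map_mul, map_one, hdet, hinv, inv_mul_cancel₀, sub_self]
      exact (Matrix.isUnits_det_units _).ne_zero
    have hD0 := aeval_laurentDualPoint_eq_zero D hDt
    -- push the relation to `k[ε]`
    have hMe : (MvPolynomial.aeval (laurentDualPoint (k := k))).mapMatrix M = dualMatrix A := by
      ext a b : 1
      rw [AlgHom.mapMatrix_apply, Matrix.map_apply, hM, Matrix.of_apply, hinl, dualPoint, dualMatrix,
        Matrix.add_apply, Matrix.map_apply, glCoordFun_inl, Units.val_one]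
      rcases eq_or_ne a b with rfl | hab
      · simp [tangentCoord]
      · simp [tangentCoord, hab]
    rw [hD, map_sub, map_one, map_mul, sub_eq_zero, AlgHom.map_det, hMe, det_dualMatrix] at hD0
    -- solve `z * (1 + ε tr A) = 1`
    set z : k[ε] := MvPolynomial.aeval (laurentDualPoint (k := k)) (Q (Sum.inr ())) with hz
    have hfst : fst z = 1 := by
      have := congrArg fst hD0
      simpa using this
    have hzeq : z = inl 1 + inr (snd z) := by
      conv_lhs => rw [← inl_fst_add_inr_snd_eq z, hfst]
    have hmul : ∀ a b : k, (inl 1 + inr a : k[ε]) * (inl 1 + inr b) = inl 1 + inr (a + b) :=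
      fun a b => TrivSqZeroExt.ext (by simp) (by simp [add_comm])
    have hsnd : snd z = -Matrix.trace A := by
      rw [hzeq, hmul] at hD0
      have h2 := congrArg snd hD0
      rw [snd_add, snd_inl, snd_inr, zero_add, TrivSqZeroExt.snd_one] at h2
      linear_combination h2
    refine TrivSqZeroExt.ext ?_ ?_
    · rw [hfst, fst_dualPoint, glCoordFun_inr, Units.val_one, Matrix.det_one, inv_one]
    · rw [hsnd, snd_dualPoint]; rfl

/-- For any polynomial `p` in the coordinates of `GL_n`: `p (1 + ε γ'(1)) = (p ∘ Q)(1 + ε, 1 - ε)`.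
[folklore] -/
theorem IsLaurentCoordsOf.aeval_dualPoint_laurentVelocity [Infinite k] (hQ : IsLaurentCoordsOf γ Q)
    (h1 : γ 1 = 1) (p : MvPolynomial (GLCoord n) k) :
    MvPolynomial.aeval (dualPoint (laurentVelocity Q)) p =
      MvPolynomial.aeval laurentDualPoint (MvPolynomial.bind₁ Q p) := by
  rw [MvPolynomial.aeval_bind₁, hQ.aeval_laurentDualPoint_eq_dualPoint h1]

/-- `(p ∘ Q)(t, t⁻¹) = p (γ t)`. [folklore] -/
lemma IsLaurentCoordsOf.eval_bind₁_eq (hQ : IsLaurentCoordsOf γ Q) (t : kˣ)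
    (p : MvPolynomial (GLCoord n) k) :
    MvPolynomial.eval ![(t : k), ((t⁻¹ : kˣ) : k)] (MvPolynomial.bind₁ Q p) =
      MvPolynomial.eval (glCoordFun (γ t)) p := by
  have hfun : (fun c => MvPolynomial.eval ![(t : k), ((t⁻¹ : kˣ) : k)] (Q c)) = glCoordFun (γ t) :=
    funext fun c => (hQ t c).symm
  rw [eval_bind₁, hfun]

/-- **The velocity of a Laurent curve in `H` lies in `Lie(H)`** (`𝔾ₘ → H`, Springer 4.4.9).
[cite: SpringerLAG1998, 4.4.9] -/
theorem IsLaurentCoordsOf.laurentVelocity_mem_lieAlgebraGL [Infinite k] (hQ : IsLaurentCoordsOf γ Q)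
    (h1 : γ 1 = 1) {H : Subgroup (GL n k)} (hH : ∀ t, γ t ∈ H) :
    laurentVelocity Q ∈ lieAlgebraGL H := by
  rw [mem_lieAlgebraGL_iff_aeval]
  intro p hp
  rw [hQ.aeval_dualPoint_laurentVelocity h1]
  apply aeval_laurentDualPoint_eq_zero
  intro t
  rw [hQ.eval_bind₁_eq]
  exact (MvPolynomial.mem_vanishingIdeal_iff.1 hp) _ ⟨γ t, hH t, rfl⟩

/-- `(x^m)(1 + ε, 1 - ε) = 1 + m ε` for the Laurent monomial `x^m`, `m ∈ ℤ`. [folklore] -/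
lemma aeval_laurentDualPoint_laurentMonomial (m : ℤ) :
    MvPolynomial.aeval laurentDualPoint (laurentMonomial m : MvPolynomial (Fin 2) k) =
      inl 1 + inr (m : k) := by
  unfold laurentMonomial
  split_ifs with h
  · rw [map_pow, MvPolynomial.aeval_X, laurentDualPoint_zero, inl_one_add_inr_pow, mul_one]
    congr 2
    have : ((m.toNat : ℤ) : k) = (m : k) := by rw [Int.toNat_of_nonneg h]
    rw [← this, Int.cast_natCast]
  · rw [map_pow, MvPolynomial.aeval_X, laurentDualPoint_one, inl_one_add_inr_pow, mul_neg, mul_one]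
    congr 2
    have h' : (((-m).toNat : ℕ) : ℤ) = -m := Int.toNat_of_nonneg (by omega)
    rw [show (((-m).toNat : ℕ) : k) = ((((-m).toNat : ℕ) : ℤ) : k) by norm_cast, h', Int.cast_neg,
      neg_neg]

/-- **If `p (γ(t)) = t^m` for all `t ∈ kˣ` then `dp_1 (γ'(1)) = m`** (the derivative at `t = 1` of
`t^m`; used with `p` a character of a torus and `γ` a cocharacter, Springer 3.2.11). [folklore] -/
theorem IsLaurentCoordsOf.tangentDeriv_laurentVelocity [Infinite k] (hQ : IsLaurentCoordsOf γ Q)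
    (h1 : γ 1 = 1) {p : MvPolynomial (GLCoord n) k} {m : ℤ}
    (hp : ∀ t : kˣ, MvPolynomial.eval (glCoordFun (γ t)) p = ((t ^ m : kˣ) : k)) :
    tangentDeriv p (laurentVelocity Q) = m := by
  have hR : ∀ t : kˣ, MvPolynomial.eval ![(t : k), ((t⁻¹ : kˣ) : k)]
      (MvPolynomial.bind₁ Q p - laurentMonomial m) = 0 := by
    intro t
    rw [map_sub, hQ.eval_bind₁_eq, hp t, eval_laurentMonomial, sub_self]
  have h0 := aeval_laurentDualPoint_eq_zero _ hR
  rw [map_sub, sub_eq_zero, ← hQ.aeval_dualPoint_laurentVelocity h1,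
    aeval_laurentDualPoint_laurentMonomial] at h0
  have := congrArg snd h0
  rw [snd_add, snd_inl, snd_inr, zero_add] at this
  rw [tangentDeriv, this]

end Curve

/-! ### Cocharacters -/

section Cochar

variable {n : Type*} [Fintype n] [DecidableEq n] {T : Subgroup (GL n k)} {γ : kˣ →* ↥T}

/-- The velocity `dλ(1) ∈ 𝔤𝔩ₙ` of an algebraic cocharacter `λ : 𝔾ₘ → T` (computed on the Laurent
coordinates provided by `IsAlgebraicCochar`). [folklore] -/
def IsAlgebraicCochar.velocity (hγ : IsAlgebraicCochar γ) : Matrix n n k :=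
  laurentVelocity hγ.choose

/-- The chosen Laurent coordinates of an algebraic cocharacter are Laurent coordinates of the
underlying curve. [folklore] -/
lemma IsAlgebraicCochar.isLaurentCoordsOf (hγ : IsAlgebraicCochar γ) :
    IsLaurentCoordsOf (fun t => ((γ t : ↥T) : GL n k)) hγ.choose :=
  hγ.choose_spec

/-- **`dλ(1) ∈ Lie(T)`** for an algebraic cocharacter `λ` of `T`. [cite: SpringerLAG1998, 4.4.9] -/
theorem IsAlgebraicCochar.velocity_mem_lieAlgebraGL [Infinite k] (hγ : IsAlgebraicCochar γ) :
    hγ.velocity ∈ lieAlgebraGL T :=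
  hγ.isLaurentCoordsOf.laurentVelocity_mem_lieAlgebraGL (by simp) fun t => (γ t).2

/-- **`dχ (dλ) = ⟨χ, λ⟩`** (Springer 3.2.11): for an algebraic character `χ` of `T` represented by
the polynomial `p` and an algebraic cocharacter `λ`, the differential `dp_1` takes the value
`⟨χ, λ⟩ = charPairingInt χ λ` on the velocity of `λ`, because `χ (λ t) = t ^ ⟨χ, λ⟩`.
[cite: SpringerLAG1998, 3.2.11] -/
theorem IsAlgebraicCochar.tangentDeriv_velocity [Infinite k] (hγ : IsAlgebraicCochar γ)
    {χ : ↥T →* kˣ} {p : MvPolynomial (GLCoord n) k}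
    (hp : ∀ t : ↥T, ((χ t : kˣ) : k) = MvPolynomial.eval (glCoordFun (t : GL n k)) p) :
    tangentDeriv p hγ.velocity = charPairingInt χ γ := by
  have hχ : IsAlgebraicChar χ := ⟨p, hp⟩
  refine hγ.isLaurentCoordsOf.tangentDeriv_laurentVelocity (by simp) fun t => ?_
  rw [← hp, charPairingInt_spec_holds hχ hγ t]

end Cochar

/-! ### The diagonal of an algebraic `SL₂ → G` -/

section SL2

variable {n : Type*} [Fintype n] [DecidableEq n] {G : Subgroup (GL n k)} {φ : SL(2, k) →* ↥G}
  (hφ : IsAlgebraicSL2Hom φ)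

/-- The substitution `(a, b; c, d) ↦ (x₀, 0; 0, x₁)` turning the polynomial representation of
`φ` into Laurent coordinates of `t ↦ φ (diag(t, t⁻¹))`. [folklore] -/
def diagSubst : Fin 2 × Fin 2 → MvPolynomial (Fin 2) k := fun ab =>
  if ab.1 = ab.2 then MvPolynomial.X ab.1 else 0

/-- The Laurent coordinates of `t ↦ φ (diag(t, t⁻¹))`. [folklore] -/
def sl2DiagCoords : GLCoord n → MvPolynomial (Fin 2) k := fun c =>
  MvPolynomial.bind₁ diagSubst (hφ.choose c)

/-- `sl2DiagCoords` are Laurent coordinates of `t ↦ φ (diag(t, t⁻¹))`. [folklore] -/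
theorem isLaurentCoordsOf_sl2DiagCoords :
    IsLaurentCoordsOf (fun t : kˣ => ((φ (diagSL2 t) : ↥G) : GL n k)) (sl2DiagCoords hφ) := by
  intro t c
  have hfun : (fun ij : Fin 2 × Fin 2 => ((diagSL2 t : SL(2, k)) : Matrix (Fin 2) (Fin 2) k) ij.1 ij.2) =
      fun ab => MvPolynomial.eval ![(t : k), ((t⁻¹ : kˣ) : k)] (diagSubst ab) := by
    funext ab
    rcases ab with ⟨a, b⟩
    fin_cases a <;> fin_cases b <;> simp [diagSubst, coe_diagSL2]
  rw [glCoordFun_eq_eval_choose hφ, sl2DiagCoords, eval_bind₁, hfun]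

/-- The substitution evaluated at the dual point is the point `1 + ε H` of `SL₂`. [folklore] -/
lemma aeval_laurentDualPoint_diagSubst :
    (fun ab => MvPolynomial.aeval (laurentDualPoint (k := k)) (diagSubst ab : MvPolynomial (Fin 2) k)) =
      sl2Point (slH : Matrix (Fin 2) (Fin 2) k) := by
  funext ab
  rcases ab with ⟨a, b⟩
  fin_cases a <;> fin_cases b <;>
    simp [diagSubst, sl2Point, slH, Literature.RingTheory.KrullDimension.dualNumberPoint,
      laurentDualPoint]

/-- **`dφ (H)` is the velocity of `t ↦ φ (diag(t, t⁻¹))`** (`H = diag(1, -1)` is the velocity of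
`t ↦ diag(t, t⁻¹)` at `t = 1`). [folklore] -/
theorem sl2Diff_slH_eq_laurentVelocity : sl2Diff hφ slH = laurentVelocity (sl2DiagCoords hφ) := by
  ext i j
  rw [laurentVelocity, Matrix.of_apply, sl2DiagCoords, MvPolynomial.aeval_bind₁,
    aeval_laurentDualPoint_diagSubst, sl2Diff, Matrix.of_apply]

/-- `dφ (H) ∈ Lie(T)` as soon as `φ (diag(t, t⁻¹)) ∈ T` for all `t` (e.g. `T` a torus containing
the coroot `φ ∘ diag`). [cite: SpringerLAG1998, 4.4.9] -/
theorem sl2Diff_slH_mem_lieAlgebraGL [Infinite k] {T : Subgroup (GL n k)}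
    (hT : ∀ t : kˣ, ((φ (diagSL2 t) : ↥G) : GL n k) ∈ T) : sl2Diff hφ slH ∈ lieAlgebraGL T := by
  rw [sl2Diff_slH_eq_laurentVelocity]
  exact (isLaurentCoordsOf_sl2DiagCoords hφ).laurentVelocity_mem_lieAlgebraGL (by simp) hT

/-- **`dp_1 (dφ H) = m` whenever `p (φ (diag(t, t⁻¹))) = t^m` for all `t ∈ kˣ`.** With `φ` the
`SL₂` of a root `α` of `(G, T)` (so `φ ∘ diag = α^∨`, Springer 7.3.5, 8.1.8) and `p` representing a
character `χ` of `T`, this reads `dχ (h_α) = ⟨χ, α^∨⟩` for `h_α = dφ (H)`.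
[cite: SpringerLAG1998, 3.2.11 and 7.3.5] -/
theorem tangentDeriv_sl2Diff_slH [Infinite k] {p : MvPolynomial (GLCoord n) k} {m : ℤ}
    (hp : ∀ t : kˣ, MvPolynomial.eval (glCoordFun ((φ (diagSL2 t) : ↥G) : GL n k)) p =
      ((t ^ m : kˣ) : k)) :
    tangentDeriv p (sl2Diff hφ slH) = m := by
  rw [sl2Diff_slH_eq_laurentVelocity]
  exact (isLaurentCoordsOf_sl2DiagCoords hφ).tangentDeriv_laurentVelocity (by simp) hp

end SL2

end Literature.NumberTheory.Automorphic
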